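import Summits.BirchSwinnertonDyer.BirchSwinnertonDyer.Theorems.PrintX10bUpperLinkRoad
import HarnessLib

/-!
# The X10b rank-one `p = 3` corner by the CLASS-NUMBER-COPRIME TWIST-SUPPLY road: the upper-link road with
# the Hoffstein–Luo field chosen with `3 ∤ h_K`, so that ONLY the PRINTED half U₃[3 ∤ h_K] of the one-sided
# link is consumed — the anticyclotomic μ-part at `3 ∣ h_K` (cruxes 23055 / 26623) leaves the load path,
# replaced by ONE analytic existence statement (TS3)

HONEST FRAMING (cell `run/shared/lean/pub/bsd-print-x9/`, LEAD seat bsd-line-x10b-p1 g2 on crux 23055 — now a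
PrintX10b aside — D-0154 KEY row 10): THEOREMS ONLY, conditional, helpers `--supports 23055`; no route edited,
nothing booked, nothing closed. «beyond-print theorem»: NO. BSD is not proved by any of this.

WHY. In x10b-p1-w2's upper-link road (`X10b.bsdp_rankOne_of_upperLink_of_mazurMainConjectureOnClassX10b`,
p608951; = the rank-one engine of the rev-20/26 leaf assembly `AssemblyPinnedTwinsX10b`) the one-sided link U₃
is consumed at exactly ONE imaginary quadratic field `K` per curve: the Hoffstein–Luo field
(`exists_neg_fundamental_twist_ne_zero_of_hoffsteinLuo`: `d_K ≡ 1 (mod 8)`, every `ℓ ∣ 3N_E` split,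
`L(E^K, 1) ≠ 0`, `|d_K| > 4`). U₃ is PRINT modulo cite-only facts on the frames with `3 ∤ h_K`
(`UpperHalf.upperLinkX10b_coprimeClassNumber_of_pinnedPrintFacts`, p609477: Mastella–Zerman Cor. 4.6 tied + the
pinned class-number-free transfer) and BEYOND PRINT on the frames with `3 ∣ h_K` (the μ-part of Howard's
divisibility, cruxes 26623 / 26359 / 23055). If the supply of the field can be asked to deliver `3 ∤ h_K` as
well, the beyond-print half is never touched. This file is that re-run: the rank-one theorem VERBATIM with the
supply hypothesis `hHL` (Hoffstein–Luo 1997) strengthened to (TS3) = Hoffstein–Luo's statement PLUS the clause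
«`3 ∤ h(ℚ(√d))`», and `hU3` weakened to U₃ on the `3 ∤ h_K` frames only (the letter of the registered stub
`stub_upperLink_coprimeClassNumber` of crux 23055). (TS3) is NOT a published theorem: Davenport–Heilbronn /
Nakagawa–Horie give `3 ∤ h` for at least half of the imaginary quadratic fields with prescribed local
behaviour, and Bump–Friedberg–Hoffstein / Murty–Murty / Hoffstein–Luo / Ono–Skinner give infinitely many (density
zero) non-vanishing twists in such a family — their intersection is open. It is a DIFFERENT residual (analytic,
over `ℚ`, no Iwasawa theory) for the same leaf; the pen may file it as a conjecture-grade item if wanted.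

WHAT.
* `shaTamagawa_le_index_of_heegnerPoint_of_coprimeUpperLink_of_thm331` — STEP U, Tamagawa-sharp, at a frame
  with `3 ∤ h_K`, from U₃[3 ∤ h_K] and JSW Thm. 3.3.1 (w2's lemma with the class-number binder threaded).
* `exists_neg_fundamental_twist_ne_zero_classNumberCoprime_of_supply` — from (TS3) and `w(E) = −1`: a
  square-free `d < 0`, `d ≡ 1 (mod 8)`, `|d| > B`, prescribed splitting, `L(E^d, 1) ≠ 0`, `3 ∤ h(ℚ(√d))`.
* `X10b.bsdp_rankOne_of_coprimeUpperLink_of_twistSupply` — `BSD_3(E)` at a non-CM rank-one X10b pair from the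
  published inputs of the upper-link road, the typed rank-`0` engine at the twist, U₃[3 ∤ h_K] and (TS3).

References: [HoffsteinLuo1997] Theorem; [JetchevSkinnerWan2017] Thm. 3.3.1, §7.4; [Castella2018] Thm. 3.2, §5;
[MastellaZerman2026] Cor. 4.6; [DavenportHeilbronn1971] Thm. 3; [NakagawaHorie1988] Thm. 2; [OnoSkinner1998];
`Theorems/PrintX10bUpperLinkRoad.lean` (p608951).
-/

set_option autoImplicit false
-- the REGISTERED stub namespace `Summit.BirchSwinnertonDyer.BirchSwinnertonDyer.Cruxes.…` repeats the summit name
set_option linter.dupNamespace false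

noncomputable section

open scoped Classical MatrixGroups ModularForm

open CongruenceSubgroup WeierstrassCurve NumberField IsDedekindDomain
  Literature.NumberTheory.EllipticCurves Literature.NumberTheory.EllipticCurves.ModularForms
  Literature.NumberTheory.EllipticCurves.JetchevSkinnerWan2017
  Summit.BirchSwinnertonDyer.BirchSwinnertonDyer.Theorems.Rank1ResidualX1Defs
  Summit.BirchSwinnertonDyer.Rank1Residual
  Summit.BirchSwinnertonDyer.Rank1Residual.X11b.KolyvaginBottom
  Summit.BirchSwinnertonDyer.BirchSwinnertonDyer.Rank1Residual

open Literature.NumberTheory.EllipticCurves.Rank1Residual (GoodOrd Irr Surj Ram Good ClassX10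
  norm_periodRatio_eq_one pPart_of_bsdp not_dvd_discr_of_split not_ram_of_irr_of_not_surj)

namespace Summit.BirchSwinnertonDyer.BirchSwinnertonDyer.Cruxes.BeyondCarrierDepthX10b.CoprimeTwist

/-- **STEP U, Tamagawa-sharp, at a `3 ∤ h_K` frame from U₃[3 ∤ h_K] and JSW control** — x10b-p1-w2's
`UpperHalf.shaTamagawa_le_index_of_heegnerPoint_of_upperLink_of_thm331` VERBATIM with the class-number binder
threaded: on a non-CM X10b pair over an odd-`d_K` Heegner field with `d_K < −4`, `3` split, `3 ∤ h_K`, a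
Manin-good frame and a non-torsion Heegner point `P`:
`ord_3 #Ш(E/K) + 2·ord_3 ∏_ℓ c_ℓ(E) ≤ 2·ord_3 [E(K):ℤP]`.
[cite: JetchevSkinnerWan2017, Thm. 3.3.1, §7.3.1 (eq:tamK), §7.4.1] [cite: Kolyvagin1990, Thm. A]
[cite: MatarNekovar2019, Prop. 5.26 (2)] [cite: Castella2018, Thm. 2.3, Thm. 3.2] -/
theorem shaTamagawa_le_index_of_heegnerPoint_of_coprimeUpperLink_of_thm331
    (hU : ∀ (W : WeierstrassCurve ℚ) [W.IsElliptic] [W.IsGloballyMinimal] (p : ℕ) [Fact p.Prime]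
    [NeZero (W.conductorNorm ℤ)] (K : Type) [Field K] [NumberField K],
    Literature.NumberTheory.EllipticCurves.Rank1Residual.ClassX10 W p →
    ¬ Literature.NumberTheory.EllipticCurves.Rank1Residual.Surj W 3 → ¬ W.HasCM →
    Literature.NumberTheory.EllipticCurves.IsImaginaryQuadratic K → Odd (NumberField.discr K) →
    NumberField.discr K ≠ -3 →
    Literature.NumberTheory.EllipticCurves.SatisfiesHeegnerHypothesis (W.conductorNorm ℤ) K →
    Literature.NumberTheory.EllipticCurves.SatisfiesHeegnerHypothesis p K →
    ¬ p ∣ NumberField.classNumber K →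
    (W.baseChange K).HasIrreducibleModPGaloisRep p →
    ∀ (ι : K →+* ℚ_[p]) (κ : Literature.NumberTheory.EllipticCurves.ZpExtension K p), κ.IsAnticyclotomic →
    ∀ (γ : Field.absoluteGaloisGroup K) [Fact (κ.IsTopGenerator γ)]
    (Dt : Literature.NumberTheory.EllipticCurves.ModularForms.ModularParametrizationData W
    (W.conductorNorm ℤ)), ¬ (p : ℤ) ∣ Dt.c →
    ∀ (H : Literature.NumberTheory.EllipticCurves.HeegnerDatum (W.conductorNorm ℤ) (NumberField.discr K))
    (ιC : K →+* ℂ) (P : (W.baseChange K).toAffine.Point),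
    WeierstrassCurve.Affine.Point.map ιC.toRatAlgHom P =
    Literature.NumberTheory.EllipticCurves.ModularForms.heegnerPointComplex Dt H →
    (W.baseChange K).mordellWeilRank = 1 →
    Finite (AddCommGroup.primaryComponent (W.baseChange K).sha p) → ¬ IsOfFinAddOrder P →
    ∃ n : ℕ, Summit.BirchSwinnertonDyer.Rank1Residual.X11b.AcSelmer.XAc.HasCharValuationAt
    (W.baseChange K) p κ (Summit.BirchSwinnertonDyer.Rank1Residual.X11b.inducedPlace ι) ∅ γ n ∧
    (n : ℤ) ≤ 2 * (Summit.BirchSwinnertonDyer.Rank1Residual.X11b.padicLogOrd W p ι P +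
    (padicValInt p (1 - W.frobeniusTrace p + p) : ℤ) - 1))
    (h331 : thm331_anticyclotomicControl)
    (W : WeierstrassCurve ℚ) [W.IsElliptic] [W.IsGloballyMinimal] [NeZero (W.conductorNorm ℤ)]
    (p : ℕ) [Fact p.Prime] (hX : ClassX10 W p) (hns : ¬ Surj W 3) (hcm : ¬ W.HasCM)
    (K : Type) [Field K] [NumberField K] (hKo : kolyvagin (W.conductorNorm ℤ) W K)
    (hK : IsImaginaryQuadratic K) (hodd : Odd (NumberField.discr K)) (hlt : NumberField.discr K < -4)
    (hHN : SatisfiesHeegnerHypothesis (W.conductorNorm ℤ) K) (hHp : SatisfiesHeegnerHypothesis p K)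
    (hhK : ¬ p ∣ NumberField.classNumber K)
    (Dt : ModularParametrizationData W (W.conductorNorm ℤ))
    (H : HeegnerDatum (W.conductorNorm ℤ) (NumberField.discr K)) (ιC : K →+* ℂ)
    (P : (W.baseChange K).toAffine.Point)
    (hP : WeierstrassCurve.Affine.Point.map ιC.toRatAlgHom P = heegnerPointComplex Dt H)
    (hPinf : ¬ IsOfFinAddOrder P) (hc : ¬ (p : ℤ) ∣ Dt.c) :
    padicValNat p (W.baseChange K).shaOrder + 2 * padicValNat p W.tamagawaProduct ≤
      2 * padicValNat p (AddSubgroup.zmultiples P).index := by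
  obtain ⟨hp3, hord, hirr, -⟩ := id hX
  subst hp3
  have hpP : (3 : ℕ).Prime := Fact.out
  have hp2 : (3 : ℕ) ≠ 2 := by norm_num
  have h3 : NumberField.discr K ≠ -3 := by omega
  -- rank one and finiteness over `K` (Kolyvagin, from the non-torsion Heegner point)
  obtain ⟨hrk, hshaK⟩ := hKo hK hHN ⟨Dt, H, ιC, hP⟩ hPinf
  haveI : Finite (W.baseChange K).sha := hshaK
  have hfinp : Finite (AddCommGroup.primaryComponent (W.baseChange K).sha 3) :=
    Finite.of_injective _ Subtype.val_injective
  -- (irr_K) at this field (Matar–Nekovář Prop. 5.26 (2), a tree theorem)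
  have hirrK : (W.baseChange K).HasIrreducibleModPGaloisRep 3 :=
    MatarNekovar2019.prop526_hasIrreducibleModPGaloisRep_baseChange_holds W K hK.1
      (Literature.SatisfiesHeegnerHypothesis.coprime_discr hK.1 hHN) 3 hp2 hirr
  -- the anticyclotomic datum and the embedding at a prime above `3`
  obtain ⟨κ, γ, 𝔭, hκ, hγ, h𝔭⟩ := X11b.exists_anticyclotomic_generator_prime (p := 3) hK
  haveI : Fact (κ.IsTopGenerator γ) := ⟨hγ⟩
  have hsplit : X11b.SplitsIn K 3 := hHp 3 Fact.out (dvd_refl 3)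
  obtain ⟨he, hf⟩ := X11b.degreeOne_of_splitsIn hK.1 hsplit h𝔭
  set ι : K →+* ℚ_[3] := X11b.embAt K 3 𝔭 h𝔭 he hf with hι
  -- the control link (JSW Thm. 3.3.1) at the induced place
  have hCTL : X11b.ControlOnTreeGoodAt 3 κ (X11b.inducedPlace ι) γ ι P :=
    X11b.controlOnTreeGoodAt_of_thm331_of_inducedPlace h331 le_rfl hord.1 hK hHp rfl hHN hirrK ι
      κ hκ γ hrk hfinp P hPinf
  -- the ONE-SIDED link U₃ at this datum (the `3 ∤ h_K` half only)
  have hup := hU W 3 K hX hns hcm hK hodd h3 hHN hHp hhK hirrK ι κ hκ γ Dt hc H ιC P hP hrk hfinp hPinf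
  have h := UpperHalf.sha_add_tamagawaSplit_le_of_onTreeGoodUpperLink hup hCTL
  obtain ⟨h1, h2⟩ := X11b.padicValNat_tamagawa_of_heegner_anyPrime (W := W) 3 hK rfl hHN
  rw [h1, h2, padicValNat_card_addPrimaryComponent (A := (W.baseChange K).sha) 3] at h
  rw [WeierstrassCurve.shaOrder]
  omega

/-- **The class-number-coprime twist supply delivers a NEGATIVE discriminant when `w(E) = −1`** (the sign
obstruction, as in `exists_neg_fundamental_twist_ne_zero_of_hoffsteinLuo`): from (TS3) and `w(E) = −1`, a
square-free `d < 0`, `d ≡ 1 (mod 8)`, `|d| > B`, `(d/ℓ) = 1` for all odd `ℓ ∈ S` and all odd `ℓ ∣ N_E`,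
`L(E^d, 1) ≠ 0`, and `3 ∤ h_K` for every imaginary quadratic `K` of discriminant `d`.
[cite: HoffsteinLuo1997, Theorem (§1, pp. 435–436)] [cite: MurtyMurty1997, Ch. 6 §1, p. 96] -/
theorem exists_neg_fundamental_twist_ne_zero_classNumberCoprime_of_supply (hmod : exists_isNewformOf)
    (hHL3 : ∀ (W : WeierstrassCurve ℚ) [W.IsElliptic] (S : Finset ℕ) (B : ℕ),
      ∃ d : ℤ, B < d.natAbs ∧ Squarefree d ∧ d % 8 = 1 ∧
        (∀ q ∈ S, q.Prime → q ≠ 2 → jacobiSym d q = 1) ∧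
        (W.quadraticTwist (d : ℚ)).entireLFunction 1 ≠ 0 ∧
        ∀ (K : Type) [Field K] [NumberField K],
          Literature.NumberTheory.EllipticCurves.IsImaginaryQuadratic K → NumberField.discr K = d →
          ¬ 3 ∣ NumberField.classNumber K)
    (W : WeierstrassCurve ℚ) [W.IsElliptic] (hw : W.rootNumber = -1) (S : Finset ℕ) (B : ℕ) :
    ∃ d : ℤ, d < 0 ∧ Squarefree d ∧ d % 8 = 1 ∧ B < d.natAbs ∧
      (∀ p ∈ S, p.Prime → p ≠ 2 → jacobiSym d p = 1) ∧
      (∀ p : ℕ, p.Prime → p ∣ W.conductorNorm ℤ → p ≠ 2 → jacobiSym d p = 1) ∧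
      (W.quadraticTwist (d : ℚ)).entireLFunction 1 ≠ 0 ∧
      ∀ (K : Type) [Field K] [NumberField K],
        IsImaginaryQuadratic K → NumberField.discr K = d → ¬ 3 ∣ NumberField.classNumber K := by
  have hN0 : W.conductorNorm ℤ ≠ 0 := (W.conductorNorm_pos_holds).ne'
  obtain ⟨d, hBd, hsq, hd8, hjac, hL, hh⟩ := hHL3 W (S ∪ (W.conductorNorm ℤ).primeFactors) B
  have hjacN : ∀ p : ℕ, p.Prime → p ∣ W.conductorNorm ℤ → p ≠ 2 → jacobiSym d p = 1 :=
    fun p hp hpN hp2 ↦ hjac p (Finset.mem_union_right _ (Nat.mem_primeFactors.mpr ⟨hp, hpN, hN0⟩)) hp hp2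
  have hjacS : ∀ p ∈ S, p.Prime → p ≠ 2 → jacobiSym d p = 1 :=
    fun p hp ↦ hjac p (Finset.mem_union_left _ hp)
  have hdneg : d < 0 := by
    by_contra hd0
    push Not at hd0
    have hd0' : 0 < d := lt_of_le_of_ne hd0 (Ne.symm hsq.ne_zero)
    exact hL (entireLFunction_quadraticTwist_one_eq_zero_of_pos hmod W hw hd0' hsq (by omega)
      (fun _ ↦ hd8) hjacN)
  exact ⟨d, hdneg, hsq, hd8, hBd, hjacS, hjacN, hL, hh⟩

/-- **Rank one at a non-CM X10b pair `(E,3)` by the CLASS-NUMBER-COPRIME TWIST-SUPPLY road**: x10b-p1-w2's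
`X10b.bsdp_rankOne_of_upperLink_of_mazurMainConjectureOnClassX10b` VERBATIM with (i) the field supplied by (TS3)
— Hoffstein–Luo's twist PLUS `3 ∤ h_K` — instead of Hoffstein–Luo 1997 alone, and (ii) the one-sided link U₃
consumed ONLY on the `3 ∤ h_K` frames (the letter of crux 23055's registered stub
`stub_upperLink_coprimeClassNumber`, PRINT modulo cite-only facts by p609477). Everything else unchanged:
Manin-good frame, STEP L at `3`, the index identity, the twist's rank-`0` `p`-part from the engine `hA3`, the
descent `X11b.bsdp_of_indexIdentityAt`. CONDITIONAL on (TS3) (unprinted) and the listed facts.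
[cite: JetchevSkinnerWan2017, Thm. 3.3.1, §7.4.1] [cite: YanZhu2024MainConjNonCM, Thm. 5.7 (1)]
[cite: BurungaleCastellaSkinner2025, Prop. 4.2.2] [cite: MatarNekovar2019, Prop. 5.26 (2)]
[cite: Castella2018, Thm. 3.2, §5] [cite: HoffsteinLuo1997, Theorem] -/
theorem X10b.bsdp_rankOne_of_coprimeUpperLink_of_twistSupply
    -- published inputs (named facts of the tree)
    (hGZ : ∀ (N : ℕ) [NeZero N] (W : WeierstrassCurve ℚ) (K : Type) [Field K] [NumberField K],
      gross_zagier N W K)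
    (hKo : ∀ (N : ℕ) [NeZero N] (W : WeierstrassCurve ℚ) (K : Type) [Field K] [NumberField K],
      kolyvagin N W K)
    (h526 : MatarNekovar2019.prop526_hasIrreducibleModPGaloisRep_baseChange)
    (h57 : YanZhu2026.thm57_bcs422_cgls513_generator_constantCoeff)
    (h331 : thm331_anticyclotomicControl)
    (hGr : greenberg_charValue_rankZero) (hGZK : rank_eq_analyticRank_of_analyticRank_le_one)
    (hmod : hasEntireLFunction_rat) (hpar : nonempty_modularParametrizationData)
    (hnf : exists_isNewformOf)
    (hMaz : mazur_not_dvd_maninConstant_of_odd) (hNS : integral_neronScaling_of_isGloballyMinimal)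
    -- (TS3): the class-number-coprime twist supply (NOT a published theorem)
    (hHL3 : ∀ (W : WeierstrassCurve ℚ) [W.IsElliptic] (S : Finset ℕ) (B : ℕ),
      ∃ d : ℤ, B < d.natAbs ∧ Squarefree d ∧ d % 8 = 1 ∧
        (∀ q ∈ S, q.Prime → q ≠ 2 → jacobiSym d q = 1) ∧
        (W.quadraticTwist (d : ℚ)).entireLFunction 1 ≠ 0 ∧
        ∀ (K : Type) [Field K] [NumberField K],
          Literature.NumberTheory.EllipticCurves.IsImaginaryQuadratic K → NumberField.discr K = d →
          ¬ 3 ∣ NumberField.classNumber K)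
    -- the pair
    (W : WeierstrassCurve ℚ) [W.IsElliptic] [W.IsGloballyMinimal] [NeZero (W.conductorNorm ℤ)]
    (p : ℕ) [Fact p.Prime] (hX : ClassX10 W p) (hns : ¬ Surj W 3) (hcm : ¬ W.HasCM)
    (hr : W.analyticRank = 1)
    -- U₃ on the `3 ∤ h_K` frames ONLY (print modulo cite-only facts, p609477)
    (hU3c : ∀ (W : WeierstrassCurve ℚ) [W.IsElliptic] [W.IsGloballyMinimal] (p : ℕ) [Fact p.Prime]
    [NeZero (W.conductorNorm ℤ)] (K : Type) [Field K] [NumberField K],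
    Literature.NumberTheory.EllipticCurves.Rank1Residual.ClassX10 W p →
    ¬ Literature.NumberTheory.EllipticCurves.Rank1Residual.Surj W 3 → ¬ W.HasCM →
    Literature.NumberTheory.EllipticCurves.IsImaginaryQuadratic K → Odd (NumberField.discr K) →
    NumberField.discr K ≠ -3 →
    Literature.NumberTheory.EllipticCurves.SatisfiesHeegnerHypothesis (W.conductorNorm ℤ) K →
    Literature.NumberTheory.EllipticCurves.SatisfiesHeegnerHypothesis p K →
    ¬ p ∣ NumberField.classNumber K →
    (W.baseChange K).HasIrreducibleModPGaloisRep p →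
    ∀ (ι : K →+* ℚ_[p]) (κ : Literature.NumberTheory.EllipticCurves.ZpExtension K p), κ.IsAnticyclotomic →
    ∀ (γ : Field.absoluteGaloisGroup K) [Fact (κ.IsTopGenerator γ)]
    (Dt : Literature.NumberTheory.EllipticCurves.ModularForms.ModularParametrizationData W
    (W.conductorNorm ℤ)), ¬ (p : ℤ) ∣ Dt.c →
    ∀ (H : Literature.NumberTheory.EllipticCurves.HeegnerDatum (W.conductorNorm ℤ) (NumberField.discr K))
    (ιC : K →+* ℂ) (P : (W.baseChange K).toAffine.Point),
    WeierstrassCurve.Affine.Point.map ιC.toRatAlgHom P =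
    Literature.NumberTheory.EllipticCurves.ModularForms.heegnerPointComplex Dt H →
    (W.baseChange K).mordellWeilRank = 1 →
    Finite (AddCommGroup.primaryComponent (W.baseChange K).sha p) → ¬ IsOfFinAddOrder P →
    ∃ n : ℕ, Summit.BirchSwinnertonDyer.Rank1Residual.X11b.AcSelmer.XAc.HasCharValuationAt
    (W.baseChange K) p κ (Summit.BirchSwinnertonDyer.Rank1Residual.X11b.inducedPlace ι) ∅ γ n ∧
    (n : ℤ) ≤ 2 * (Summit.BirchSwinnertonDyer.Rank1Residual.X11b.padicLogOrd W p ι P +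
    (padicValInt p (1 - W.frobeniusTrace p + p) : ℤ) - 1))
    -- the typed rank-`0` engine of the X10b lane (used at the twist only)
    (hA3 : X10.MazurMainConjectureOnClassX10b) : BSDp W p := by
  obtain ⟨hp3, ⟨hgood, hord⟩, hirr, -⟩ := id hX
  subst hp3
  have hpP : (3 : ℕ).Prime := Fact.out
  have hp2 : (3 : ℕ) ≠ 2 := by norm_num
  -- the sign of the functional equation is `−1`
  have hw : W.rootNumber = -1 := by
    rw [WeierstrassCurve.rootNumber_eq_neg_one_pow_analyticRank_of_exists_isNewformOf hnf W, hr]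
    norm_num
  -- the field: (TS3) with `|d_K| > 4`, `d_K ≡ 1 (mod 8)`, `3 ∤ h_K`
  obtain ⟨d, hdneg, hsq, hd8, hBd, hjacS, hjacN, hLd, hhd⟩ :=
    exists_neg_fundamental_twist_ne_zero_classNumberCoprime_of_supply hnf hHL3 W hw {3} 4
  have hkr : ∀ q : ℕ, q.Prime → q ∣ W.conductorNorm ℤ * 3 →
      (q = 2 → d % 8 = 1) ∧ (q ≠ 2 → jacobiSym d q = 1) := by
    intro q hq hqNp
    refine ⟨fun _ ↦ hd8, fun hq2 ↦ ?_⟩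
    rcases (Nat.Prime.dvd_mul hq).mp hqNp with hqN | hqp
    · exact hjacN q hq hqN hq2
    · have hqp' : q = 3 := (Nat.prime_dvd_prime_iff_eq hq hpP).mp hqp
      subst hqp'
      exact hjacS _ (Finset.mem_singleton_self _) hq hq2
  obtain ⟨K, _, _, hK, hBK, hH, hd8K, hLt, hhK'⟩ :=
    (exists_heegnerField_iff_exists_fundamental (W.conductorNorm ℤ * 3) 4
      (fun D ↦ D % 8 = 1 ∧ (W.quadraticTwist (D : ℚ)).entireLFunction 1 ≠ 0 ∧
        ∀ (K : Type) [Field K] [NumberField K],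
          IsImaginaryQuadratic K → NumberField.discr K = D → ¬ 3 ∣ NumberField.classNumber K)).mpr
      ⟨d, hdneg, Or.inl ⟨by omega, hsq, by omega⟩, hBd, hkr, hd8, hLd, hhd⟩
  have hhK : ¬ 3 ∣ NumberField.classNumber K := hhK' K hK rfl
  have hneg : NumberField.discr K < 0 := IsImaginaryQuadratic.discr_neg hK
  have hodd : Odd (NumberField.discr K) := Int.odd_iff.mpr (by omega)
  have hlt : NumberField.discr K < -4 := by omega
  have hHN : SatisfiesHeegnerHypothesis (W.conductorNorm ℤ) K := hH.of_dvd (dvd_mul_right _ _)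
  have hHp : SatisfiesHeegnerHypothesis 3 K := hH.of_dvd (dvd_mul_left _ _)
  -- `3 ∤ d_K` and `w_K = 2`
  have hpd : ¬ ((3 : ℕ) : ℤ) ∣ NumberField.discr K := not_dvd_discr_of_split hK hpP hp2 hHp
  have hμ : ¬ 3 ∣ Units.torsionOrder K := by
    haveI : IsTotallyComplex K := hK.2
    rw [Literature.NumberTheory.DiophantineGeometry.torsionOrder_eq_two_of_discr_lt hK.1 hlt]
    norm_num
  -- (irred_K) at this field (Matar–Nekovář Prop. 5.26 (2))
  have hirrK : (W.baseChange K).HasIrreducibleModPGaloisRep 3 :=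
    h526 W K hK.1 (Literature.SatisfiesHeegnerHypothesis.coprime_discr hK.1 hHN) 3 hp2 hirr
  -- the Manin-unit Heegner datum at the good prime `3`; `P` of infinite order (Gross–Zagier)
  obtain ⟨Dt, H, ι, P, hP, hc⟩ :=
    X11b.exists_maninDatum_of_good hnf hMaz hNS W 3 (W.conductorNorm ℤ) K rfl hp2 hgood hirr hK hHN
  have hPinf : ¬ IsOfFinAddOrder P :=
    X11b.not_isOfFinAddOrder_of_heegner_of_analyticRank_eq_one W (W.conductorNorm ℤ) K Dt H ι P
      (hGZ _ W K) hmod hr hK hHN hLt hP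
  -- finiteness over `K` (Kolyvagin)
  obtain ⟨-, hshaK⟩ := hKo (W.conductorNorm ℤ) W K hK hHN ⟨Dt, H, ι, hP⟩ hPinf
  haveI : Finite (W.baseChange K).sha := hshaK
  -- STEP U, Tamagawa-sharp, from U₃[3 ∤ h_K] and JSW control
  have hU : padicValNat 3 (Nat.card (W.baseChange K).sha) + 2 * padicValNat 3 W.tamagawaProduct ≤
      2 * padicValNat 3 (AddSubgroup.zmultiples P).index := by
    have h := shaTamagawa_le_index_of_heegnerPoint_of_coprimeUpperLink_of_thm331
      hU3c h331 W 3 hX hns hcm K (hKo _ W K) hK hodd hlt hHN hHp hhK Dt H ι P hP hPinf hc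
    rwa [WeierstrassCurve.shaOrder] at h
  -- STEP L at 3: YZ 5.7 (1) + BCS 4.2.2 ∘ CGLS 5.1.3, control from JSW 3.3.1
  obtain ⟨κ, γ, 𝔭, hκ, hγ, h𝔭⟩ := X11b.exists_anticyclotomic_generator_prime (p := 3) hK
  haveI : Fact (κ.IsTopGenerator γ) := ⟨hγ⟩
  have hsplit : X11b.SplitsIn K 3 := hHp 3 Fact.out (dvd_refl 3)
  obtain ⟨he, hf⟩ := X11b.degreeOne_of_splitsIn hK.1 hsplit h𝔭
  set ιp : K →+* ℚ_[3] := X11b.embAt K 3 𝔭 h𝔭 he hf with hιp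
  have hL : X11b.IndexLowerBoundAt W 3 K P :=
    X11b.indexLowerBoundAt_of_heegner_of_thm331_of_embedding (γ := γ) W 3 (W.conductorNorm ℤ) K Dt H
      ι P h331 (hGZ _ W K) (hKo _ W K) hmod hGZK (le_refl 3) hgood hr rfl hK hHN hHp hirrK hLt hP hκ ιp
      (X11b.imcLowerWaldspurgerOnTreeGoodAt_inducedPlace_of_heegner_of_thm57_of_thm331 (γ := γ) W 3
        (W.conductorNorm ℤ) K Dt H ι P h57 h331 (hKo _ W K) (le_refl 3) ⟨hgood, hord⟩ hirrK rfl
        hK hodd hlt hHN hHp hP hc hPinf hκ ιp)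
  -- the identity over `K`
  have hid : Finite (W.baseChange K).sha → X11b.IndexIdentityAt W 3 K P := fun _ ↦
    X9.indexIdentityAt_of_lowerBound_of_sharpUpper W 3 hL hU
  -- a globally minimal model of the twist (Néron): an X10b pair of analytic rank `0`
  have hD0 : (NumberField.discr K : ℚ) ≠ 0 := by exact_mod_cast NumberField.discr_ne_zero K
  haveI hEt : (W.quadraticTwist (NumberField.discr K : ℚ)).IsElliptic :=
    W.isElliptic_quadraticTwist hD0
  obtain ⟨Cd, hCd⟩ := hasGlobalMinimalModel_rat_holds (W.quadraticTwist (NumberField.discr K : ℚ))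
  haveI : (Cd • W.quadraticTwist (NumberField.discr K : ℚ)).IsGloballyMinimal := hCd
  have hWd : Cd • W.quadraticTwist (NumberField.discr K : ℚ) =
      Cd • W.quadraticTwist (NumberField.discr K : ℚ) := rfl
  have hLt' : (W.quadraticTwist (NumberField.discr K : ℚ)).entireLFunction =
      (Cd • W.quadraticTwist (NumberField.discr K : ℚ)).entireLFunction := by
    rw [entireLFunction_smul]
  have hLd1 : (Cd • W.quadraticTwist (NumberField.discr K : ℚ)).entireLFunction 1 ≠ 0 := by
    rw [← hLt']; exact hLt
  have hrd : (Cd • W.quadraticTwist (NumberField.discr K : ℚ)).analyticRank = 0 :=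
    ((Cd • W.quadraticTwist (NumberField.discr K : ℚ)).analyticRank_eq_zero_iff_holds (hmod _)).2 hLd1
  obtain ⟨hX10d, hnsd⟩ := classX10b_twist_model hX hns K hK.1 hpd Cd hWd hrd
  have hordd : GoodOrd (Cd • W.quadraticTwist (NumberField.discr K : ℚ)) 3 := hX10d.2.1
  have htam : padicValNat 3 (Cd • W.quadraticTwist (NumberField.discr K : ℚ)).tamagawaProduct =
      padicValNat 3 W.tamagawaProduct :=
    X2.padicValNat_tamagawaProduct_twist_of_heegner_of_odd W 3 hp2 K hK hodd hpd hHN Cd hWd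
  have hu : padicValRat 3 (Cd.u : ℚ) = 0 :=
    X11b.padicValRat_u_eq_zero_of_twist_good W 3 hpd hgood Cd hWd hordd.1
  -- the twist's rank-`0` `p`-part from the X10b engine
  have hMCd : MazurMainConjecture (Cd • W.quadraticTwist (NumberField.discr K : ℚ)) 3 :=
    hA3 _ 3 hX10d hnsd
  have hfinSd : Finite (Cd • W.quadraticTwist (NumberField.discr K : ℚ)).sha :=
    (hGZK (Cd • W.quadraticTwist (NumberField.discr K : ℚ)) (by rw [hrd]; exact zero_le_one)).2
  have htw := padicValRat_bsd_rank_zero_of_mazurMainConjecture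
    (Cd • W.quadraticTwist (NumberField.discr K : ℚ)) 3 hordd.1 hordd.2 hLd1 hfinSd hpar
    (fun κ' γ' hκ' hγ' hγ'' D _ hXt fE hfE hSel ↦
      hGr (Cd • W.quadraticTwist (NumberField.discr K : ℚ)) 3 hp2 hordd.1 hordd.2 κ' γ' hκ' hγ' hγ''
        D hXt fE hfE hSel) hMCd
  exact X11b.bsdp_of_indexIdentityAt W 3 (W.conductorNorm ℤ) K Dt H ι P (hGZ _ W K) (hKo _ W K) hGZK
    hmod hK hHN hP hp2 hc hμ hr hLt (Cd • W.quadraticTwist (NumberField.discr K : ℚ)) Cd hWd htw htam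
    hu hid

end Summit.BirchSwinnertonDyer.BirchSwinnertonDyer.Cruxes.BeyondCarrierDepthX10b.CoprimeTwist

end
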